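import Literature.Analysis.FluidPDE.NSVorticityBKMTools
import HarnessLib

/-!
# The Beale–Kato–Majda a priori estimate, II: the vorticity energy inequalities at levels
# zero and two for classical solutions in the BKM class (`ν ≥ 0`)

Analysis/FluidPDE support file (theorems only, no definitions, no named facts) on the discharge
path of `Literature.Analysis.FluidPDE.MajdaBertozzi2002_bkmAprioriH3` (`NSVorticityBKM.lean`;
Majda–Bertozzi, *Vorticity and Incompressible Flow*, CUP 2002, §3.3, proof of Thm. 3.6,
pp. 116–117). The printed proof bounds `‖v(t)‖₃` through the `H^m` energy estimate
`d/dt ‖v‖_m ≤ c_m |∇v|_{L^∞} ‖v‖_m` ((3.58), giving (3.79)) and `‖ω(t)‖₀` through the enstrophy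
balance of the vorticity equation (3.81), `d/dt ‖ω‖₀ ≤ |∇v|_{L^∞}‖ω‖₀` ((3.82)), both "for
`ν ≥ 0`". Here both are run on the vorticity equation — which eliminates the pressure, on which
the tree's class `IsClassicalNSSolutionOn` puts no condition — with the coordinate energy method
of the tree (`NSVorticityEnergy`, `NSVorticitySlice`, `NSEnstrophyPersistence`: cutoffs `χ_R⁴`,
the differentiated vorticity equation `vorticity_transport` and its forcing bound, the viscous and
transport pairings `component_pairing_le`, time integration `integral_cutoff_vortSq_sub_eq`), but
closed, instead of by the viscosity as in Tao's `X¹` theory, by the Beale–Kato–Majda quantities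
`|∇u|_{L^∞}` (level two) and `|ω|_{L^∞}` (level zero):

* `bkm_pairing_le_zero`, `bkm_pairing_le_two` — the fixed-time pairings for a smooth
  divergence-free `v` bounded by `B`, a cutoff with `‖Dφ‖ ≤ c`, and continuous `Ẇ_c` obeying the
  forcing bound of the differentiated vorticity equation:
  `Σ_c 2∫φ⁴Ẇ_cW_c ≤ (96νc² + 12cB)∫|Ω|² + 432 Ω_∞ ∫|∇v|²` at level zero (`Ω_∞ ≥ |curl v|`;
  the stretching `∫|Ω||∇v|²`), and at level two, with `|∇v| ≤ D`,
  `Σ_c 2∫φ⁴Ẇ_cW_c ≤ (96νc² + 12cB + K|D|)∫|∇²Ω|²` (`K` absolute): the forcing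
  `Σ_{a=1}^3 |∇ᵃv||∇^{4−a}v| = 2|∇v||∇³v| + |∇²v|²` is paired with `|∇²Ω|` by Cauchy–Schwarz,
  the whole-space div–curl inequality `∫|∇³v|² ≤ ∫|∇²Ω|²` and the Gagliardo–Nirenberg inequality
  `∫|∇²v|⁴ ≤ 144 D² ∫|∇³v|²` (`NSVorticityBKMTools`) — the commutator estimate of
  Majda–Bertozzi Prop. 3.7 at `m = 3`;
* `IsClassicalNSSolutionOn.bkm_vortSq_zero_le`, `….bkm_vortSq_two_le` — **the integrated
  inequalities on a closed slab** `[0, T]` for an unforced classical solution (`ν ≥ 0`) with all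
  Sobolev seminorms bounded on `[0, T]` (`HasBoundedSobolevNormsOn`): for every `t ∈ [0, T]`,
  `∫|Ω(t)|² ≤ ∫|Ω(0)|² + ∫₀ᵗ 432 a(τ) ∫|Ω(τ)|² dτ` whenever `a(τ) ≥ sup_x |curl u(τ)|`, and
  `∫|∇²Ω(t)|² ≤ ∫|∇²Ω(0)|² + ∫₀ᵗ K G(τ) ∫|∇²Ω(τ)|² dτ` whenever `G(τ) ≥ sup_x ‖Du(τ)‖`
  (the error terms of the cutoff are `O(1/R)` on the slab and the cutoff is removed by dominated
  convergence). The time integrals are lower Lebesgue integrals, so that no measurability of the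
  suprema `a`, `G` is needed; they are the form consumed by the tree's measurability-free
  Grönwall lemma `lintegral_gronwall_le` in the assembly (`NSVorticityBKMProofs`).

## Mathlib / tree search

Tree (all used): `component_pairing_le`, `transport_pairing_eq`, `viscous_pairing_le`
(`NSVorticitySlice`); `IsClassicalNSSolutionOn.abs_vorticity_forcing_le`, `sum_sq_vortFam`,
`sum_sq_pderiv_vortFam`, `integrable_pow_mul_of_continuous` (`NSVorticityEnergy`);
`IsClassicalNSSolutionOn.integral_cutoff_vortSq_sub_eq`, `….isSmoothSpaceTimeOn_vortFam`,
`….continuousOn_integral_cutoff_pow_mul_timeDerivWithin_mul`, `….continuousOn_integral_cutoff_pow_mul_vortSq`,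
`Icc_subset_closure_interior`, `integrableOn_Ioo_of_continuousOn` (`NSEnstrophyPersistence`);
`integral_levelSq_two_sq_le`,
`abs_vortFam_le_sqrt_vortSq`, `abs_vortFam_zero_le_two_mul_norm_curl`,
`levelSq_bounds_of_hasBoundedSobolevNormsOn`, `tendsto_integral_cutoff_pow_mul_atTop`
(`NSVorticityBKMTools`); `integral_levelSq_succ_le_integral_vortSq` (`NSStrongSpeedBound`); `integral_mul_le_sqrt_mul_sqrt_of_memLp` (`EnergyToolkit`);
`cutoff`, `exists_norm_fderiv_cutoff_le` (`WholeSpaceIBP`). Mathlib: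
`integral_eq_lintegral_pos_part_sub_lintegral_neg_part`, `lintegral_add_right'`,
`le_of_tendsto_of_tendsto`.

## References

* A. J. Majda, A. L. Bertozzi, *Vorticity and Incompressible Flow*, CUP 2002, §3.2 Prop. 3.7
  (3.58); §3.3 proof of Thm. 3.6, (3.79)–(3.82) (held text pp. 116–117). [MajdaBertozzi2002]
* J. T. Beale, T. Kato, A. Majda, Comm. Math. Phys. 94 (1984), 61–66, (9)–(12).
  [BealeKatoMajda1984]
-/

noncomputable section

open MeasureTheory Set Function Filter
open _root_.Topology
open scoped ENNReal NNReal ContDiff BigOperators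

namespace Literature.Analysis.FluidPDE

/-! ## Fixed-time pairings -/

section Pairing

variable {v : (EuclideanSpace ℝ (Fin 3)) → (EuclideanSpace ℝ (Fin 3))} {φ : (EuclideanSpace ℝ (Fin 3)) → ℝ}

/-- **The viscous and transport pairings, summed over the components, for `ν ≥ 0`.** For a
smooth divergence-free `v` with `|v| ≤ B`, a smooth compactly supported `0 ≤ φ ≤ 1` with
`|∂ₗφ| ≤ c`, and any level `n` with `|∇ⁿΩ|² ∈ L¹`:
`Σ_c [ν(−(3/2)∫φ⁴|∇W_c|² + 96c²∫φ²W_c²) + ∫4φ³(∇φ·v)W_c²] ≤ (96νc² + 12cB) ∫|∇ⁿΩ|²`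
(the dissipation is discarded, `ν ≥ 0`; `φ² ≤ 1`, `|∇φ·v| ≤ 3cB`). [folklore] -/
theorem viscous_transport_sum_le {ν c B : ℝ} (hν : 0 ≤ ν) (hc : 0 ≤ c) (hv : ContDiff ℝ ∞ v)
    (hvB : ∀ x, ‖v x‖ ≤ B) (hφ : ContDiff ℝ ∞ φ) (hφc : HasCompactSupport φ)
    (hφ0 : ∀ x, 0 ≤ φ x) (hφ1 : ∀ x, φ x ≤ 1) (hpφ : ∀ l x, |pderiv l φ x| ≤ c) (n : ℕ)
    (hΩ : Integrable (vortSq n v)) :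
    ∑ c', (ν * (-(3 / 2) * (∫ x, φ x ^ 4 * ∑ j, pderiv j (vortFam n v c') x ^ 2) +
        96 * c ^ 2 * ∫ x, φ x ^ 2 * vortFam n v c' x ^ 2) +
      ∫ x, 4 * φ x ^ 3 * (∑ j, pderiv j φ x * v x j) * vortFam n v c' x ^ 2) ≤
      (96 * ν * c ^ 2 + 12 * c * B) * ∫ x, vortSq n v x := by
  have hφcont := hφ.continuous
  have hB0 : 0 ≤ B := (norm_nonneg _).trans (hvB 0)
  have hWsm : ∀ c', ContDiff ℝ ∞ (vortFam n v c') := fun c' => contDiff_vortFam hv n c'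
  -- components squared are dominated by `|∇ⁿΩ|²`
  have hWsq_le : ∀ c' x, vortFam n v c' x ^ 2 ≤ vortSq n v x := fun c' x => by
    rw [← sum_sq_vortFam n v x]
    exact Finset.single_le_sum (f := fun d => vortFam n v d x ^ 2) (fun _ _ => sq_nonneg _)
      (Finset.mem_univ c')
  have iWsq : ∀ c', Integrable fun x => vortFam n v c' x ^ 2 := fun c' =>
    hΩ.mono' (((hWsm c').continuous.pow 2)).aestronglyMeasurable
      (Eventually.of_forall fun x => by
        rw [Real.norm_of_nonneg (sq_nonneg _)]; exact hWsq_le c' x)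
  -- (1) the dissipation is nonnegative
  have e1 : ∀ c', 0 ≤ ∫ x, φ x ^ 4 * ∑ j, pderiv j (vortFam n v c') x ^ 2 := fun c' =>
    integral_nonneg fun x => mul_nonneg (pow_nonneg (hφ0 x) 4)
      (Finset.sum_nonneg fun _ _ => sq_nonneg _)
  -- (2) `Σ ∫ φ² W_c² ≤ ∫ |∇ⁿΩ|²`
  have iB : ∀ c', Integrable fun x => φ x ^ 2 * vortFam n v c' x ^ 2 := fun c' =>
    integrable_pow_mul_of_continuous hφcont hφc ((hWsm c').continuous.pow 2) (by norm_num)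
  have e2 : ∑ c', ∫ x, φ x ^ 2 * vortFam n v c' x ^ 2 ≤ ∫ x, vortSq n v x := by
    calc ∑ c', ∫ x, φ x ^ 2 * vortFam n v c' x ^ 2 = ∫ x, φ x ^ 2 * vortSq n v x := by
          rw [← integral_finsetSum _ fun c' _ => iB c']
          refine integral_congr_ae (Eventually.of_forall fun x => ?_)
          simp only
          rw [← Finset.mul_sum, sum_sq_vortFam]
      _ ≤ ∫ x, vortSq n v x := by
          refine integral_mono ?_ hΩ fun x => ?_
          · exact integrable_pow_mul_of_continuous hφcont hφc (continuous_vortSq hv n) (by norm_num)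
          · calc φ x ^ 2 * vortSq n v x ≤ 1 * vortSq n v x :=
                  mul_le_mul_of_nonneg_right (pow_le_one₀ (hφ0 x) (hφ1 x)) (vortSq_nonneg n v x)
              _ = vortSq n v x := one_mul _
  -- (3) transport terms
  have cdφ : ∀ j, Continuous (pderiv j φ) := fun j => continuous_pderiv hφ (by simp) j
  have cV : ∀ j, Continuous fun y => v y j := fun j => (contDiff_comp_of_contDiff hv j).continuous
  have hs : ∀ x, |∑ j, pderiv j φ x * v x j| ≤ 3 * (c * B) := by
    intro x
    calc |∑ j, pderiv j φ x * v x j| ≤ ∑ j, |pderiv j φ x * v x j| := Finset.abs_sum_le_sum_abs _ _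
      _ ≤ ∑ _j : Fin 3, c * B := Finset.sum_le_sum fun j _ => by
          rw [abs_mul]
          refine mul_le_mul (hpφ j x) ?_ (abs_nonneg _) hc
          have := PiLp.norm_apply_le (v x) j
          rw [Real.norm_eq_abs] at this
          exact this.trans (hvB x)
      _ = 3 * (c * B) := by simp
  have e3 : ∑ c', ∫ x, 4 * φ x ^ 3 * (∑ j, pderiv j φ x * v x j) * vortFam n v c' x ^ 2 ≤
      12 * c * B * ∫ x, vortSq n v x := by
    have hi : ∀ c', Integrable fun x => 4 * φ x ^ 3 * (∑ j, pderiv j φ x * v x j) *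
        vortFam n v c' x ^ 2 := by
      intro c'
      have : (fun x => 4 * φ x ^ 3 * (∑ j, pderiv j φ x * v x j) * vortFam n v c' x ^ 2) =
          fun x => φ x ^ 3 * (4 * (∑ j, pderiv j φ x * v x j) * vortFam n v c' x ^ 2) := by
        funext x; ring
      rw [this]
      exact integrable_pow_mul_of_continuous hφcont hφc ((continuous_const.mul
        (continuous_finsetSum _ fun j _ => (cdφ j).mul (cV j))).mul ((hWsm c').continuous.pow 2))
        (by norm_num)
    have hle : ∀ c', ∫ x, 4 * φ x ^ 3 * (∑ j, pderiv j φ x * v x j) * vortFam n v c' x ^ 2 ≤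
        12 * c * B * ∫ x, vortFam n v c' x ^ 2 := by
      intro c'
      rw [← integral_const_mul]
      refine integral_mono (hi c') ((iWsq c').const_mul _) fun x => ?_
      have hφ3 : 0 ≤ φ x ^ 3 := pow_nonneg (hφ0 x) 3
      have hφ3' : φ x ^ 3 ≤ 1 := pow_le_one₀ (hφ0 x) (hφ1 x)
      have hW2 : 0 ≤ vortFam n v c' x ^ 2 := sq_nonneg _
      calc 4 * φ x ^ 3 * (∑ j, pderiv j φ x * v x j) * vortFam n v c' x ^ 2
          ≤ 4 * φ x ^ 3 * |∑ j, pderiv j φ x * v x j| * vortFam n v c' x ^ 2 :=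
            mul_le_mul_of_nonneg_right (mul_le_mul_of_nonneg_left (le_abs_self _) (by positivity))
              hW2
        _ ≤ 4 * 1 * (3 * (c * B)) * vortFam n v c' x ^ 2 :=
            mul_le_mul_of_nonneg_right (mul_le_mul (mul_le_mul_of_nonneg_left hφ3' (by norm_num))
              (hs x) (abs_nonneg _) (by norm_num)) hW2
        _ = 12 * c * B * vortFam n v c' x ^ 2 := by ring
    calc ∑ c', ∫ x, 4 * φ x ^ 3 * (∑ j, pderiv j φ x * v x j) * vortFam n v c' x ^ 2
        ≤ ∑ c', 12 * c * B * ∫ x, vortFam n v c' x ^ 2 := Finset.sum_le_sum fun c' _ => hle c'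
      _ = 12 * c * B * ∫ x, vortSq n v x := by
          rw [← Finset.mul_sum, ← integral_finsetSum _ fun c' _ => iWsq c']
          congr 1
          exact integral_congr_ae (Eventually.of_forall fun x => by
            simp only; exact sum_sq_vortFam n v x)
  -- assemble
  have hy0 : 0 ≤ ∫ x, vortSq n v x := integral_nonneg fun x => vortSq_nonneg n v x
  calc ∑ c', (ν * (-(3 / 2) * (∫ x, φ x ^ 4 * ∑ j, pderiv j (vortFam n v c') x ^ 2) +
          96 * c ^ 2 * ∫ x, φ x ^ 2 * vortFam n v c' x ^ 2) +
        ∫ x, 4 * φ x ^ 3 * (∑ j, pderiv j φ x * v x j) * vortFam n v c' x ^ 2)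
      ≤ ∑ c', (ν * (96 * c ^ 2 * ∫ x, φ x ^ 2 * vortFam n v c' x ^ 2) +
          ∫ x, 4 * φ x ^ 3 * (∑ j, pderiv j φ x * v x j) * vortFam n v c' x ^ 2) := by
        refine Finset.sum_le_sum fun c' _ => add_le_add ?_ le_rfl
        refine mul_le_mul_of_nonneg_left ?_ hν
        nlinarith [e1 c']
    _ = ν * (96 * c ^ 2) * (∑ c', ∫ x, φ x ^ 2 * vortFam n v c' x ^ 2) +
          ∑ c', ∫ x, 4 * φ x ^ 3 * (∑ j, pderiv j φ x * v x j) * vortFam n v c' x ^ 2 := by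
        rw [Finset.sum_add_distrib, Finset.mul_sum]
        congr 1
        exact Finset.sum_congr rfl fun c' _ => by ring
    _ ≤ ν * (96 * c ^ 2) * (∫ x, vortSq n v x) + 12 * c * B * ∫ x, vortSq n v x :=
        add_le_add (mul_le_mul_of_nonneg_left e2 (by positivity)) e3
    _ = (96 * ν * c ^ 2 + 12 * c * B) * ∫ x, vortSq n v x := by ring

/-- **The Beale–Kato–Majda pairing at level zero** (the enstrophy balance of Majda–Bertozzi
(3.81)–(3.82), localised, with the stretching paired against `|ω|_{L^∞}`). For a smooth
divergence-free `v` with `|v| ≤ B`, `|curl v| ≤ Ω_∞`, `|∇v|² ∈ L¹`, a cutoff as above and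
continuous `Ẇ_c` whose vorticity forcing `F_c = Ẇ_c − νΔW_c + v·∇W_c` obeys `|F_c| ≤ 12 |∇v|²`
(`W_c = Ω_{ki}`):
`Σ_c 2∫φ⁴ Ẇ_c W_c ≤ (96νc² + 12cB) ∫|Ω|² + 432 Ω_∞ ∫|∇v|²`. [cite: MajdaBertozzi2002, §3.3 proof of Thm. 3.6, (3.81)–(3.82) (p. 116)] -/
theorem bkm_pairing_le_zero {ν c B Ω : ℝ} (hν : 0 ≤ ν) (hc : 0 ≤ c) (hΩ0 : 0 ≤ Ω)
    (hv : ContDiff ℝ ∞ v) (hdiv : ∀ x, ∑ i, pderiv i (fun y => v y i) x = 0)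
    (hvB : ∀ x, ‖v x‖ ≤ B) (hvΩ : ∀ x, ‖curl v x‖ ≤ Ω)
    (h1 : Integrable (levelSq 1 v))
    (hφ : ContDiff ℝ ∞ φ) (hφc : HasCompactSupport φ) (hφ0 : ∀ x, 0 ≤ φ x) (hφ1 : ∀ x, φ x ≤ 1)
    (hcφ : ∀ x, ‖fderiv ℝ φ x‖ ≤ c)
    (Wdot : (Fin 0 → Fin 3) × Fin 3 × Fin 3 → (EuclideanSpace ℝ (Fin 3)) → ℝ) (hWc : ∀ c', Continuous (Wdot c'))
    (hforce : ∀ c' x, |Wdot c' x - ν * ∑ j, pderiv j (pderiv j (vortFam 0 v c')) x +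
        ∑ j, v x j * pderiv j (vortFam 0 v c') x| ≤ 12 * levelSq 1 v x) :
    ∑ c', 2 * ∫ x, φ x ^ 4 * (Wdot c' x * vortFam 0 v c' x) ≤
      (96 * ν * c ^ 2 + 12 * c * B) * (∫ x, vortSq 0 v x) + 432 * Ω * ∫ x, levelSq 1 v x := by
  have hpφ : ∀ l x, |pderiv l φ x| ≤ c := fun l x => (abs_pderiv_le_norm_fderiv l φ x).trans (hcφ x)
  have hφcont := hφ.continuous
  have hvd : Differentiable ℝ v := hv.differentiable (by simp)
  have hy_int : Integrable (vortSq 0 v) :=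
    (h1.const_mul 4).mono' (continuous_vortSq hv 0).aestronglyMeasurable
      (Eventually.of_forall fun x => by
        rw [Real.norm_of_nonneg (vortSq_nonneg 0 v x)]
        exact vortSq_le_four_mul_levelSq_succ hv 0 x)
  have hWsm : ∀ c', ContDiff ℝ ∞ (vortFam 0 v c') := fun c' => contDiff_vortFam hv 0 c'
  have hcomp := fun c' => component_pairing_le (hWsm c') (hWc c') hv hdiv hφ hφc hφ0 hpφ hν
    (Wdot := Wdot c')
  have hsum := Finset.sum_le_sum fun c' (_ : c' ∈ Finset.univ) => hcomp c'
  have hVT := viscous_transport_sum_le hν hc hv hvB hφ hφc hφ0 hφ1 hpφ 0 hy_int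
  -- the forcing terms
  set F : (Fin 0 → Fin 3) × Fin 3 × Fin 3 → (EuclideanSpace ℝ (Fin 3)) → ℝ := fun c' x =>
    Wdot c' x - ν * ∑ j, pderiv j (pderiv j (vortFam 0 v c')) x +
      ∑ j, v x j * pderiv j (vortFam 0 v c') x with hF_def
  have cV : ∀ j, Continuous fun y => v y j := fun j => (contDiff_comp_of_contDiff hv j).continuous
  have cdW : ∀ c' j, Continuous (pderiv j (vortFam 0 v c')) := fun c' j =>
    continuous_pderiv (hWsm c') (by simp) j
  have cF : ∀ c', Continuous (F c') := fun c' =>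
    ((hWc c').sub (continuous_const.mul (continuous_finsetSum _ fun j _ =>
      continuous_pderiv (contDiff_pderiv (hWsm c') j) (by simp) j))).add
      (continuous_finsetSum _ fun j _ => (cV j).mul (cdW c' j))
  have hA1c : Continuous (levelSq 1 v) := continuous_levelSq hv 1
  have e4 : ∀ c', 2 * ∫ x, φ x ^ 4 * (vortFam 0 v c' x * F c' x) ≤ 48 * Ω * ∫ x, levelSq 1 v x := by
    intro c'
    have iL : Integrable fun x => φ x ^ 4 * (vortFam 0 v c' x * F c' x) :=
      integrable_pow_mul_of_continuous hφcont hφc ((hWsm c').continuous.mul (cF c')) (by norm_num)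
    have step : ∫ x, φ x ^ 4 * (vortFam 0 v c' x * F c' x) ≤ 24 * Ω * ∫ x, levelSq 1 v x := by
      rw [← integral_const_mul]
      refine integral_mono iL (h1.const_mul _) fun x => ?_
      have hφ4 : 0 ≤ φ x ^ 4 := pow_nonneg (hφ0 x) 4
      have hφ4' : φ x ^ 4 ≤ 1 := pow_le_one₀ (hφ0 x) (hφ1 x)
      have hFx : |F c' x| ≤ 12 * levelSq 1 v x := hforce c' x
      have hWx : |vortFam 0 v c' x| ≤ 2 * Ω :=
        (abs_vortFam_zero_le_two_mul_norm_curl hvd c' x).trans (by linarith [hvΩ x])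
      have hL0 : 0 ≤ levelSq 1 v x := levelSq_nonneg 1 v x
      calc φ x ^ 4 * (vortFam 0 v c' x * F c' x) ≤ φ x ^ 4 * (|vortFam 0 v c' x| * |F c' x|) := by
            refine mul_le_mul_of_nonneg_left ?_ hφ4
            rw [← abs_mul]; exact le_abs_self _
        _ ≤ 1 * (2 * Ω * (12 * levelSq 1 v x)) :=
            mul_le_mul hφ4' (mul_le_mul hWx hFx (abs_nonneg _) (by positivity))
              (mul_nonneg (abs_nonneg _) (abs_nonneg _)) zero_le_one
        _ = 24 * Ω * levelSq 1 v x := by ring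
    linarith
  have e4s : ∑ c', 2 * ∫ x, φ x ^ 4 * (vortFam 0 v c' x * F c' x) ≤ 432 * Ω * ∫ x, levelSq 1 v x := by
    calc ∑ c', 2 * ∫ x, φ x ^ 4 * (vortFam 0 v c' x * F c' x)
        ≤ ∑ _c' : (Fin 0 → Fin 3) × Fin 3 × Fin 3, 48 * Ω * ∫ x, levelSq 1 v x :=
          Finset.sum_le_sum fun c' _ => e4 c'
      _ = 432 * Ω * ∫ x, levelSq 1 v x := by
          simp only [Finset.sum_const, Finset.card_univ, Fintype.card_prod, Fintype.card_fun,
            Fintype.card_fin, nsmul_eq_mul]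
          push_cast; ring
  -- assemble
  have hF_eq : ∀ c', (∫ x, φ x ^ 4 * (vortFam 0 v c' x * (Wdot c' x -
      ν * ∑ j, pderiv j (pderiv j (vortFam 0 v c')) x + ∑ j, v x j * pderiv j (vortFam 0 v c') x))) =
      ∫ x, φ x ^ 4 * (vortFam 0 v c' x * F c' x) := fun c' => rfl
  simp only [hF_eq] at hsum
  calc ∑ c', 2 * ∫ x, φ x ^ 4 * (Wdot c' x * vortFam 0 v c' x)
      ≤ ∑ c', (ν * (-(3 / 2) * (∫ x, φ x ^ 4 * ∑ j, pderiv j (vortFam 0 v c') x ^ 2) +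
            96 * c ^ 2 * ∫ x, φ x ^ 2 * vortFam 0 v c' x ^ 2) +
          (∫ x, 4 * φ x ^ 3 * (∑ j, pderiv j φ x * v x j) * vortFam 0 v c' x ^ 2) +
          2 * ∫ x, φ x ^ 4 * (vortFam 0 v c' x * F c' x)) := hsum
    _ = ∑ c', (ν * (-(3 / 2) * (∫ x, φ x ^ 4 * ∑ j, pderiv j (vortFam 0 v c') x ^ 2) +
            96 * c ^ 2 * ∫ x, φ x ^ 2 * vortFam 0 v c' x ^ 2) +
          ∫ x, 4 * φ x ^ 3 * (∑ j, pderiv j φ x * v x j) * vortFam 0 v c' x ^ 2) +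
          ∑ c', 2 * ∫ x, φ x ^ 4 * (vortFam 0 v c' x * F c' x) := Finset.sum_add_distrib
    _ ≤ (96 * ν * c ^ 2 + 12 * c * B) * (∫ x, vortSq 0 v x) + 432 * Ω * ∫ x, levelSq 1 v x :=
        add_le_add hVT e4s

/-- The level-two forcing sum: `Σ_{a ∈ [1,3]} √A_a √A_{4−a} = 2 √A₁ √A₃ + A₂`. [folklore] -/
theorem sum_Icc_one_three_sqrt_levelSq (v : (EuclideanSpace ℝ (Fin 3)) → (EuclideanSpace ℝ (Fin 3)))
    (x : (EuclideanSpace ℝ (Fin 3))) :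
    ∑ a ∈ Finset.Icc 1 (2 + 1), Real.sqrt (levelSq a v x) * Real.sqrt (levelSq (2 + 2 - a) v x) =
      2 * (Real.sqrt (levelSq 1 v x) * Real.sqrt (levelSq 3 v x)) + levelSq 2 v x := by
  have hI : Finset.Icc 1 (2 + 1) = ({1, 2, 3} : Finset ℕ) := by decide
  rw [hI, Finset.sum_insert (by decide), Finset.sum_insert (by decide), Finset.sum_singleton]
  rw [show (2 + 2 - 1 : ℕ) = 3 from rfl, show (2 + 2 - 2 : ℕ) = 2 from rfl,
    show (2 + 2 - 3 : ℕ) = 1 from rfl, Real.mul_self_sqrt (levelSq_nonneg 2 v x)]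
  ring

/-- **The Beale–Kato–Majda pairing at level two** (the `H³` energy estimate of Majda–Bertozzi
Prop. 3.7 / (3.79) with `m = 3`, run on the twice differentiated vorticity equation and localised).
For a smooth divergence-free `v` with `|v| ≤ B`, `|∇v|² ≤ D²`, `|∇²v|²` and `|∇³v|²` bounded,
`|∇v|², |∇²v|², |∇³v|² ∈ L¹`, a cutoff as above and continuous `Ẇ_c` whose forcing obeys the bound
of the differentiated vorticity equation `|F_c| ≤ 48 Σ_{a=1}^3 |∇ᵃv||∇^{4−a}v|`
(`W_c = ∂^βΩ_{ki}`, `|β| = 2`):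
`Σ_c 2∫φ⁴ Ẇ_c W_c ≤ (96νc² + 12cB + 326592 |D|) ∫|∇²Ω|²`.
The forcing `2|∇v||∇³v| + |∇²v|²` is paired with `|W_c| ≤ |∇²Ω|` by Cauchy–Schwarz, and
`∫|∇³v|² ≤ ∫|∇²Ω|²` (whole-space div–curl), `∫|∇²v|⁴ ≤ 144 D²∫|∇³v|²` (Gagliardo–Nirenberg).
[cite: MajdaBertozzi2002, §3.3 proof of Thm. 3.6, (3.79) with §3.2 Prop. 3.7 (pp. 104, 116)] -/
theorem bkm_pairing_le_two {ν c B D P₂ P₃ : ℝ} (hν : 0 ≤ ν) (hc : 0 ≤ c)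
    (hv : ContDiff ℝ ∞ v) (hdiv : ∀ x, ∑ i, pderiv i (fun y => v y i) x = 0)
    (hvB : ∀ x, ‖v x‖ ≤ B) (hD : ∀ x, levelSq 1 v x ≤ D ^ 2)
    (hP₂ : ∀ x, levelSq 2 v x ≤ P₂) (hP₃ : ∀ x, levelSq 3 v x ≤ P₃)
    (h2 : Integrable (levelSq 2 v)) (h3 : Integrable (levelSq 3 v))
    (hφ : ContDiff ℝ ∞ φ) (hφc : HasCompactSupport φ) (hφ0 : ∀ x, 0 ≤ φ x) (hφ1 : ∀ x, φ x ≤ 1)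
    (hcφ : ∀ x, ‖fderiv ℝ φ x‖ ≤ c)
    (Wdot : (Fin 2 → Fin 3) × Fin 3 × Fin 3 → (EuclideanSpace ℝ (Fin 3)) → ℝ)
    (hWc : ∀ c', Continuous (Wdot c'))
    (hforce : ∀ c' x, |Wdot c' x - ν * ∑ j, pderiv j (pderiv j (vortFam 2 v c')) x +
        ∑ j, v x j * pderiv j (vortFam 2 v c') x| ≤
      48 * ∑ a ∈ Finset.Icc 1 (2 + 1),
        Real.sqrt (levelSq a v x) * Real.sqrt (levelSq (2 + 2 - a) v x)) :
    ∑ c', 2 * ∫ x, φ x ^ 4 * (Wdot c' x * vortFam 2 v c' x) ≤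
      (96 * ν * c ^ 2 + 12 * c * B + 326592 * |D|) * ∫ x, vortSq 2 v x := by
  have hpφ : ∀ l x, |pderiv l φ x| ≤ c := fun l x => (abs_pderiv_le_norm_fderiv l φ x).trans (hcφ x)
  have hφcont := hφ.continuous
  have hP₂0 : 0 ≤ P₂ := (levelSq_nonneg 2 v 0).trans (hP₂ 0)
  -- integrability of `|∇²Ω|²`, the quantities `X = ∫|∇²Ω|²`, `∫|∇³v|² ≤ X`, `∫|∇²v|⁴ ≤ 144 D² X`
  have hX_int : Integrable (vortSq 2 v) :=
    (h3.const_mul 4).mono' (continuous_vortSq hv 2).aestronglyMeasurable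
      (Eventually.of_forall fun x => by
        rw [Real.norm_of_nonneg (vortSq_nonneg 2 v x)]
        exact vortSq_le_four_mul_levelSq_succ hv 2 x)
  set X := ∫ x, vortSq 2 v x with hX
  have hX0 : 0 ≤ X := integral_nonneg fun x => vortSq_nonneg 2 v x
  have hL3_le : ∫ x, levelSq 3 v x ≤ X := integral_levelSq_succ_le_integral_vortSq hv hdiv 2 h2 h3
  have hL30 : 0 ≤ ∫ x, levelSq 3 v x := integral_nonneg fun x => levelSq_nonneg 3 v x
  have hGN : ∫ x, levelSq 2 v x ^ 2 ≤ 144 * D ^ 2 * X :=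
    (integral_levelSq_two_sq_le hv hD hP₂ hP₃ h2 h3).trans
      (mul_le_mul_of_nonneg_left hL3_le (by positivity))
  -- the per-component and summed viscous/transport pairings
  have hWsm : ∀ c', ContDiff ℝ ∞ (vortFam 2 v c') := fun c' => contDiff_vortFam hv 2 c'
  have hcomp := fun c' => component_pairing_le (hWsm c') (hWc c') hv hdiv hφ hφc hφ0 hpφ hν
    (Wdot := Wdot c')
  have hsum := Finset.sum_le_sum fun c' (_ : c' ∈ Finset.univ) => hcomp c'
  have hVT := viscous_transport_sum_le hν hc hv hvB hφ hφc hφ0 hφ1 hpφ 2 hX_int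
  -- the forcing terms
  set F : (Fin 2 → Fin 3) × Fin 3 × Fin 3 → (EuclideanSpace ℝ (Fin 3)) → ℝ := fun c' x =>
    Wdot c' x - ν * ∑ j, pderiv j (pderiv j (vortFam 2 v c')) x +
      ∑ j, v x j * pderiv j (vortFam 2 v c') x with hF_def
  have cV : ∀ j, Continuous fun y => v y j := fun j => (contDiff_comp_of_contDiff hv j).continuous
  have cdW : ∀ c' j, Continuous (pderiv j (vortFam 2 v c')) := fun c' j =>
    continuous_pderiv (hWsm c') (by simp) j
  have cF : ∀ c', Continuous (F c') := fun c' =>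
    ((hWc c').sub (continuous_const.mul (continuous_finsetSum _ fun j _ =>
      continuous_pderiv (contDiff_pderiv (hWsm c') j) (by simp) j))).add
      (continuous_finsetSum _ fun j _ => (cV j).mul (cdW c' j))
  have cL : ∀ m, Continuous (levelSq m v) := fun m => continuous_levelSq hv m
  have cVs : Continuous fun x => Real.sqrt (vortSq 2 v x) := Real.continuous_sqrt.comp (continuous_vortSq hv 2)
  have cL3s : Continuous fun x => Real.sqrt (levelSq 3 v x) := Real.continuous_sqrt.comp (cL 3)
  -- the two Cauchy–Schwarz pairings
  have mVs : MemLp (fun x => Real.sqrt (vortSq 2 v x)) 2 volume := by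
    refine (memLp_two_iff_integrable_sq cVs.aestronglyMeasurable).2 ?_
    exact hX_int.congr (Eventually.of_forall fun x => (Real.sq_sqrt (vortSq_nonneg 2 v x)).symm)
  have mL3s : MemLp (fun x => Real.sqrt (levelSq 3 v x)) 2 volume := by
    refine (memLp_two_iff_integrable_sq cL3s.aestronglyMeasurable).2 ?_
    exact h3.congr (Eventually.of_forall fun x => (Real.sq_sqrt (levelSq_nonneg 3 v x)).symm)
  have iL2sq : Integrable fun x => levelSq 2 v x ^ 2 :=
    (h2.const_mul P₂).mono' ((cL 2).pow 2).aestronglyMeasurable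
      (Eventually.of_forall fun x => by
        rw [Real.norm_of_nonneg (sq_nonneg _), sq]
        exact mul_le_mul_of_nonneg_right (hP₂ x) (levelSq_nonneg 2 v x))
  have mL2 : MemLp (levelSq 2 v) 2 volume :=
    (memLp_two_iff_integrable_sq (cL 2).aestronglyMeasurable).2 iL2sq
  have hCS1 : ∫ x, Real.sqrt (vortSq 2 v x) * Real.sqrt (levelSq 3 v x) ≤ X := by
    have h := integral_mul_le_sqrt_mul_sqrt_of_memLp mVs mL3s
    have e1 : ∫ x, Real.sqrt (vortSq 2 v x) ^ 2 = X :=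
      integral_congr_ae (Eventually.of_forall fun x => Real.sq_sqrt (vortSq_nonneg 2 v x))
    have e2 : ∫ x, Real.sqrt (levelSq 3 v x) ^ 2 = ∫ x, levelSq 3 v x :=
      integral_congr_ae (Eventually.of_forall fun x => Real.sq_sqrt (levelSq_nonneg 3 v x))
    rw [e1, e2] at h
    calc ∫ x, Real.sqrt (vortSq 2 v x) * Real.sqrt (levelSq 3 v x)
        ≤ Real.sqrt X * Real.sqrt (∫ x, levelSq 3 v x) := h
      _ ≤ Real.sqrt X * Real.sqrt X := mul_le_mul_of_nonneg_left (Real.sqrt_le_sqrt hL3_le) (Real.sqrt_nonneg _)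
      _ = X := Real.mul_self_sqrt hX0
  have hCS2 : ∫ x, Real.sqrt (vortSq 2 v x) * levelSq 2 v x ≤ 12 * |D| * X := by
    have h := integral_mul_le_sqrt_mul_sqrt_of_memLp mVs mL2
    have e1 : ∫ x, Real.sqrt (vortSq 2 v x) ^ 2 = X :=
      integral_congr_ae (Eventually.of_forall fun x => Real.sq_sqrt (vortSq_nonneg 2 v x))
    rw [e1] at h
    have e2 : Real.sqrt (∫ x, levelSq 2 v x ^ 2) ≤ 12 * |D| * Real.sqrt X := by
      calc Real.sqrt (∫ x, levelSq 2 v x ^ 2) ≤ Real.sqrt (144 * D ^ 2 * X) := Real.sqrt_le_sqrt hGN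
        _ = 12 * |D| * Real.sqrt X := by
            rw [Real.sqrt_mul (by positivity), Real.sqrt_mul (by norm_num),
              show (144 : ℝ) = 12 ^ 2 by norm_num, Real.sqrt_sq (by norm_num), Real.sqrt_sq_eq_abs]
    calc ∫ x, Real.sqrt (vortSq 2 v x) * levelSq 2 v x
        ≤ Real.sqrt X * Real.sqrt (∫ x, levelSq 2 v x ^ 2) := h
      _ ≤ Real.sqrt X * (12 * |D| * Real.sqrt X) := mul_le_mul_of_nonneg_left e2 (Real.sqrt_nonneg _)
      _ = 12 * |D| * (Real.sqrt X * Real.sqrt X) := by ring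
      _ = 12 * |D| * X := by rw [Real.mul_self_sqrt hX0]
  -- the per-component forcing bound
  have hsqD : ∀ x, Real.sqrt (levelSq 1 v x) ≤ |D| := fun x => by
    rw [← Real.sqrt_sq_eq_abs]; exact Real.sqrt_le_sqrt (hD x)
  have i1 : Integrable fun x => Real.sqrt (vortSq 2 v x) * Real.sqrt (levelSq 3 v x) := by
    refine ((hX_int.add h3).div_const 2).mono' (cVs.mul cL3s).aestronglyMeasurable
      (Eventually.of_forall fun x => ?_)
    rw [Real.norm_of_nonneg (mul_nonneg (Real.sqrt_nonneg _) (Real.sqrt_nonneg _))]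
    show _ ≤ (vortSq 2 v x + levelSq 3 v x) / 2
    nlinarith [sq_nonneg (Real.sqrt (vortSq 2 v x) - Real.sqrt (levelSq 3 v x)),
      Real.sq_sqrt (vortSq_nonneg 2 v x), Real.sq_sqrt (levelSq_nonneg 3 v x)]
  have i2 : Integrable fun x => Real.sqrt (vortSq 2 v x) * levelSq 2 v x := by
    refine ((hX_int.add iL2sq).div_const 2).mono' (cVs.mul (cL 2)).aestronglyMeasurable
      (Eventually.of_forall fun x => ?_)
    rw [Real.norm_of_nonneg (mul_nonneg (Real.sqrt_nonneg _) (levelSq_nonneg 2 v x))]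
    show _ ≤ (vortSq 2 v x + levelSq 2 v x ^ 2) / 2
    nlinarith [sq_nonneg (Real.sqrt (vortSq 2 v x) - levelSq 2 v x),
      Real.sq_sqrt (vortSq_nonneg 2 v x)]
  have hMeq : (fun x => Real.sqrt (vortSq 2 v x) * (2 * |D| * Real.sqrt (levelSq 3 v x) + levelSq 2 v x)) =
      fun x => 2 * |D| * (Real.sqrt (vortSq 2 v x) * Real.sqrt (levelSq 3 v x)) +
        Real.sqrt (vortSq 2 v x) * levelSq 2 v x := by
    funext x; ring
  have iM : Integrable fun x => Real.sqrt (vortSq 2 v x) *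
      (2 * |D| * Real.sqrt (levelSq 3 v x) + levelSq 2 v x) := by
    rw [hMeq]
    exact (i1.const_mul _).add i2
  have e4 : ∀ c', 2 * ∫ x, φ x ^ 4 * (vortFam 2 v c' x * F c' x) ≤ 4032 * |D| * X := by
    intro c'
    have iL : Integrable fun x => φ x ^ 4 * (vortFam 2 v c' x * F c' x) :=
      integrable_pow_mul_of_continuous hφcont hφc ((hWsm c').continuous.mul (cF c')) (by norm_num)
    have step1 : ∫ x, φ x ^ 4 * (vortFam 2 v c' x * F c' x) ≤
        48 * ∫ x, Real.sqrt (vortSq 2 v x) * (2 * |D| * Real.sqrt (levelSq 3 v x) + levelSq 2 v x) := by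
      rw [← integral_const_mul]
      refine integral_mono iL (iM.const_mul 48) fun x => ?_
      have hφ4 : 0 ≤ φ x ^ 4 := pow_nonneg (hφ0 x) 4
      have hφ4' : φ x ^ 4 ≤ 1 := pow_le_one₀ (hφ0 x) (hφ1 x)
      have hFx : |F c' x| ≤ 48 * (2 * (Real.sqrt (levelSq 1 v x) * Real.sqrt (levelSq 3 v x)) +
          levelSq 2 v x) := by
        have := hforce c' x
        rw [sum_Icc_one_three_sqrt_levelSq v x] at this
        exact this
      have hFx' : |F c' x| ≤ 48 * (2 * |D| * Real.sqrt (levelSq 3 v x) + levelSq 2 v x) := by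
        refine hFx.trans (mul_le_mul_of_nonneg_left ?_ (by norm_num))
        have h3s : 0 ≤ Real.sqrt (levelSq 3 v x) := Real.sqrt_nonneg _
        nlinarith [mul_le_mul_of_nonneg_right (hsqD x) h3s]
      have hWx : |vortFam 2 v c' x| ≤ Real.sqrt (vortSq 2 v x) := abs_vortFam_le_sqrt_vortSq 2 v c' x
      have hM0 : 0 ≤ 2 * |D| * Real.sqrt (levelSq 3 v x) + levelSq 2 v x := by
        have := levelSq_nonneg 2 v x; positivity
      calc φ x ^ 4 * (vortFam 2 v c' x * F c' x) ≤ φ x ^ 4 * (|vortFam 2 v c' x| * |F c' x|) := by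
            refine mul_le_mul_of_nonneg_left ?_ hφ4
            rw [← abs_mul]; exact le_abs_self _
        _ ≤ 1 * (Real.sqrt (vortSq 2 v x) *
              (48 * (2 * |D| * Real.sqrt (levelSq 3 v x) + levelSq 2 v x))) :=
            mul_le_mul hφ4' (mul_le_mul hWx hFx' (abs_nonneg _) (Real.sqrt_nonneg _))
              (mul_nonneg (abs_nonneg _) (abs_nonneg _)) zero_le_one
        _ = 48 * (Real.sqrt (vortSq 2 v x) * (2 * |D| * Real.sqrt (levelSq 3 v x) + levelSq 2 v x)) := by
            ring
    have step2 : ∫ x, Real.sqrt (vortSq 2 v x) * (2 * |D| * Real.sqrt (levelSq 3 v x) + levelSq 2 v x) ≤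
        2 * |D| * X + 12 * |D| * X := by
      rw [hMeq, integral_add (i1.const_mul _) i2, integral_const_mul]
      exact add_le_add (mul_le_mul_of_nonneg_left hCS1 (by positivity)) hCS2
    nlinarith [step1, step2, abs_nonneg D, hX0]
  have e4s : ∑ c', 2 * ∫ x, φ x ^ 4 * (vortFam 2 v c' x * F c' x) ≤ 326592 * |D| * X := by
    calc ∑ c', 2 * ∫ x, φ x ^ 4 * (vortFam 2 v c' x * F c' x)
        ≤ ∑ _c' : (Fin 2 → Fin 3) × Fin 3 × Fin 3, 4032 * |D| * X :=
          Finset.sum_le_sum fun c' _ => e4 c'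
      _ = 326592 * |D| * X := by
          simp only [Finset.sum_const, Finset.card_univ, Fintype.card_prod, Fintype.card_fun,
            Fintype.card_fin, nsmul_eq_mul]
          push_cast; ring
  -- assemble
  have hF_eq : ∀ c', (∫ x, φ x ^ 4 * (vortFam 2 v c' x * (Wdot c' x -
      ν * ∑ j, pderiv j (pderiv j (vortFam 2 v c')) x + ∑ j, v x j * pderiv j (vortFam 2 v c') x))) =
      ∫ x, φ x ^ 4 * (vortFam 2 v c' x * F c' x) := fun c' => rfl
  simp only [hF_eq] at hsum
  calc ∑ c', 2 * ∫ x, φ x ^ 4 * (Wdot c' x * vortFam 2 v c' x)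
      ≤ ∑ c', (ν * (-(3 / 2) * (∫ x, φ x ^ 4 * ∑ j, pderiv j (vortFam 2 v c') x ^ 2) +
            96 * c ^ 2 * ∫ x, φ x ^ 2 * vortFam 2 v c' x ^ 2) +
          (∫ x, 4 * φ x ^ 3 * (∑ j, pderiv j φ x * v x j) * vortFam 2 v c' x ^ 2) +
          2 * ∫ x, φ x ^ 4 * (vortFam 2 v c' x * F c' x)) := hsum
    _ = ∑ c', (ν * (-(3 / 2) * (∫ x, φ x ^ 4 * ∑ j, pderiv j (vortFam 2 v c') x ^ 2) +
            96 * c ^ 2 * ∫ x, φ x ^ 2 * vortFam 2 v c' x ^ 2) +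
          ∫ x, 4 * φ x ^ 3 * (∑ j, pderiv j φ x * v x j) * vortFam 2 v c' x ^ 2) +
          ∑ c', 2 * ∫ x, φ x ^ 4 * (vortFam 2 v c' x * F c' x) := Finset.sum_add_distrib
    _ ≤ (96 * ν * c ^ 2 + 12 * c * B) * X + 326592 * |D| * X := add_le_add hVT e4s
    _ = (96 * ν * c ^ 2 + 12 * c * B + 326592 * |D|) * ∫ x, vortSq 2 v x := by rw [hX]; ring

end Pairing

/-! ## Time integration on a closed slab and removal of the cutoff -/

section Slab

variable {T ν : ℝ} {u : ℝ → (EuclideanSpace ℝ (Fin 3)) → (EuclideanSpace ℝ (Fin 3))}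
  {p : ℝ → (EuclideanSpace ℝ (Fin 3)) → ℝ}

/-- For an integrable real function, `∫ f ≤ (∫⁻ f⁺).toReal` (drop the negative part). [folklore] -/
theorem integral_le_toReal_lintegral_ofReal {α : Type*} [MeasurableSpace α] {μ : Measure α}
    {f : α → ℝ} (hf : Integrable f μ) :
    ∫ x, f x ∂μ ≤ (∫⁻ x, ENNReal.ofReal (f x) ∂μ).toReal := by
  rw [integral_eq_lintegral_pos_part_sub_lintegral_neg_part hf]
  exact sub_le_self _ ENNReal.toReal_nonneg

/-- **From a slice bound to an integrated inequality, removing the cutoff.** For an unforced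
classical solution on `[0, T] × ℝ³` with `|∇ⁿΩ(τ)|² ∈ L¹` for all `τ ∈ [0, T]`: if for every
`R ≥ 1` and `τ ∈ [0, T]` the localised pairing `Σ_c 2∫χ_R⁴ ∂ₜW_c W_c` is at most `m(τ) + E/R`
with `0 ≤ m ≤ M` on `[0, T]`, then `∫|∇ⁿΩ(t)|² ≤ ∫|∇ⁿΩ(0)|² + ∫₀ᵗ m` for every `t ∈ [0, T]`,
the time integral being the lower Lebesgue integral of the (possibly non-measurable) majorant
`m` (the fundamental theorem of calculus in time, `integral_cutoff_vortSq_sub_eq`, and dominated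
convergence `R → ∞` at the fixed times `0` and `t`). [folklore] -/
theorem IsClassicalNSSolutionOn.integral_vortSq_le_of_slice_bound
    (h : IsClassicalNSSolutionOn (Icc 0 T) ν 0 u p) (hT : 0 < T) (n : ℕ)
    (hXint : ∀ τ ∈ Icc 0 T, Integrable (vortSq n (u τ)))
    {m : ℝ → ℝ} {M E : ℝ} (hm0 : ∀ τ ∈ Icc 0 T, 0 ≤ m τ) (hmM : ∀ τ ∈ Icc 0 T, m τ ≤ M)
    (hE : 0 ≤ E)
    (hslice : ∀ R : ℝ, 1 ≤ R → ∀ τ ∈ Icc 0 T,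
      ∑ c', 2 * ∫ x, cutoff R x ^ 4 *
        (timeDerivWithin (Icc 0 T) (fun s y => vortFam n (u s) c' y) τ x * vortFam n (u τ) c' x) ≤
        m τ + E / R)
    {t : ℝ} (ht : t ∈ Icc 0 T) :
    ∫ x, vortSq n (u t) x ≤ (∫ x, vortSq n (u 0) x) +
      (∫⁻ τ in Ioo 0 t, ENNReal.ofReal (m τ)).toReal := by
  have h0T : (0 : ℝ) ∈ Icc 0 T := ⟨le_rfl, hT.le⟩
  have hM0 : 0 ≤ M := (hm0 0 h0T).trans (hmM 0 h0T)
  set Λ : ℝ≥0∞ := ∫⁻ τ in Ioo 0 t, ENNReal.ofReal (m τ) with hΛ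
  -- the majorant has a finite integral
  have hΛfin : Λ ≠ ⊤ := by
    refine ne_top_of_le_ne_top (b := ∫⁻ _ in Ioo (0 : ℝ) t, ENNReal.ofReal M) ?_ ?_
    · rw [setLIntegral_const, Real.volume_Ioo]
      exact ENNReal.mul_ne_top ENNReal.ofReal_ne_top ENNReal.ofReal_ne_top
    · exact setLIntegral_mono' measurableSet_Ioo fun τ hτ =>
        ENNReal.ofReal_le_ofReal (hmM τ ⟨hτ.1.le, hτ.2.le.trans ht.2⟩)
  -- the inequality at cutoff radius `R ≥ 1`
  have hR : ∀ R : ℝ, 1 ≤ R → ∫ x, cutoff R x ^ 4 * vortSq n (u t) x ≤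
      (∫ x, vortSq n (u 0) x) + Λ.toReal + E * T / R := by
    intro R hR1
    have hR0 : 0 < R := by linarith
    set Φ : ℝ → ℝ := fun τ => ∑ c', 2 * ∫ x, cutoff R x ^ 4 *
      (timeDerivWithin (Icc 0 T) (fun s y => vortFam n (u s) c' y) τ x * vortFam n (u τ) c' x) with hΦ
    have cΦ : ContinuousOn Φ (Icc 0 T) := by
      rw [hΦ]
      exact continuousOn_finsetSum _ fun c' _ =>
        (h.continuousOn_integral_cutoff_pow_mul_timeDerivWithin_mul hT hR0 n c').const_smul (2 : ℝ)
          |>.congr fun t _ => by simp [smul_eq_mul]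
    have hFTC : (∫ x, cutoff R x ^ 4 * vortSq n (u t) x) - ∫ x, cutoff R x ^ 4 * vortSq n (u 0) x =
        ∫ τ in Ioo 0 t, Φ τ := by
      rw [hΦ]; exact h.integral_cutoff_vortSq_sub_eq hT hR0 n ht
    have iΦ : IntegrableOn Φ (Ioo 0 t) := integrableOn_Ioo_of_continuousOn cΦ ht
    -- `∫ Φ ≤ (∫⁻ Φ⁺).toReal ≤ (∫⁻ (m + E/R)).toReal = Λ.toReal + E t / R`
    have hER : 0 ≤ E / R := div_nonneg hE hR0.le
    have h1 : ∫ τ in Ioo 0 t, Φ τ ≤ (∫⁻ τ in Ioo 0 t, ENNReal.ofReal (Φ τ)).toReal :=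
      integral_le_toReal_lintegral_ofReal iΦ
    have h2 : ∫⁻ τ in Ioo 0 t, ENNReal.ofReal (Φ τ) ≤ Λ + ENNReal.ofReal (E / R) * ENNReal.ofReal t := by
      calc ∫⁻ τ in Ioo 0 t, ENNReal.ofReal (Φ τ)
          ≤ ∫⁻ τ in Ioo 0 t, (ENNReal.ofReal (m τ) + ENNReal.ofReal (E / R)) :=
            setLIntegral_mono' measurableSet_Ioo fun τ hτ => by
              have hτ' : τ ∈ Icc 0 T := ⟨hτ.1.le, hτ.2.le.trans ht.2⟩
              rw [← ENNReal.ofReal_add (hm0 τ hτ') hER]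
              exact ENNReal.ofReal_le_ofReal (hslice R hR1 τ hτ')
        _ = Λ + ∫⁻ _ in Ioo (0 : ℝ) t, ENNReal.ofReal (E / R) :=
            lintegral_add_right' _ aemeasurable_const
        _ = Λ + ENNReal.ofReal (E / R) * ENNReal.ofReal t := by
            rw [setLIntegral_const, Real.volume_Ioo, sub_zero]
    have h3 : (∫⁻ τ in Ioo 0 t, ENNReal.ofReal (Φ τ)).toReal ≤ Λ.toReal + E / R * t := by
      have hfin : Λ + ENNReal.ofReal (E / R) * ENNReal.ofReal t ≠ ⊤ :=
        ENNReal.add_ne_top.2 ⟨hΛfin, ENNReal.mul_ne_top ENNReal.ofReal_ne_top ENNReal.ofReal_ne_top⟩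
      calc (∫⁻ τ in Ioo 0 t, ENNReal.ofReal (Φ τ)).toReal
          ≤ (Λ + ENNReal.ofReal (E / R) * ENNReal.ofReal t).toReal := ENNReal.toReal_mono hfin h2
        _ = Λ.toReal + E / R * t := by
            rw [ENNReal.toReal_add hΛfin (ENNReal.mul_ne_top ENNReal.ofReal_ne_top ENNReal.ofReal_ne_top),
              ENNReal.toReal_mul, ENNReal.toReal_ofReal hER, ENNReal.toReal_ofReal ht.1]
    have h4 : E / R * t ≤ E * T / R := by
      rw [div_mul_eq_mul_div]
      exact div_le_div_of_nonneg_right (mul_le_mul_of_nonneg_left ht.2 hE) hR0.le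
    have h5 : ∫ x, cutoff R x ^ 4 * vortSq n (u 0) x ≤ ∫ x, vortSq n (u 0) x :=
      integral_pow_mul_le_integral (continuous_vortSq (h.contDiff_velocity h0T) n) (vortSq_nonneg n _)
        (hXint 0 h0T) (contDiff_cutoff R) (hasCompactSupport_cutoff hR0) (cutoff_nonneg R)
        (cutoff_le_one R) (by norm_num)
    linarith
  -- remove the cutoff at time `t`
  have hlim1 := tendsto_integral_cutoff_pow_mul_atTop (hXint t ht) 4
  have hlim2 : Tendsto (fun R : ℝ => (∫ x, vortSq n (u 0) x) + Λ.toReal + E * T / R) atTop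
      (𝓝 ((∫ x, vortSq n (u 0) x) + Λ.toReal + 0)) := by
    refine tendsto_const_nhds.add ?_
    simpa using (tendsto_const_nhds (x := E * T)).div_atTop tendsto_id
  rw [add_zero] at hlim2
  exact le_of_tendsto_of_tendsto hlim1 hlim2 (eventually_atTop.2 ⟨1, hR⟩)

/-- **The integrated enstrophy inequality in the BKM class** (Majda–Bertozzi (3.80)–(3.82),
integrated: `‖ω(t)‖₀² ≤ ‖ω₀‖₀² + ∫₀ᵗ 2|∇v|_∞‖ω‖₀²`, here with the stretching paired against
`|ω|_{L^∞}` and `‖∇v‖₀ ≤ ‖ω‖₀`). For `ν ≥ 0` and an unforced classical solution on `[0, T] × ℝ³`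
all of whose Sobolev seminorms are bounded on `[0, T]`, and any majorant `a(τ) ≥ sup_x |curl u(τ)|`
bounded on `[0, T]`: for every `t ∈ [0, T]`,
`∫|Ω(t)|² ≤ ∫|Ω(0)|² + ∫₀ᵗ 432 a(τ) ∫|Ω(τ)|² dτ` (lower Lebesgue integral in time;
`|Ω|² = 2|curl u|²`). [cite: MajdaBertozzi2002, §3.3 proof of Thm. 3.6, (3.80)–(3.82) (p. 116)] -/
theorem IsClassicalNSSolutionOn.bkm_vortSq_zero_le
    (h : IsClassicalNSSolutionOn (Icc 0 T) ν 0 u p) (hν : 0 ≤ ν) (hT : 0 < T)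
    (hB : HasBoundedSobolevNormsOn (Icc 0 T) u)
    {a : ℝ → ℝ} {amax : ℝ} (ha : ∀ τ ∈ Icc 0 T, ∀ x, ‖curl (u τ) x‖ ≤ a τ)
    (hamax : ∀ τ ∈ Icc 0 T, a τ ≤ amax) {t : ℝ} (ht : t ∈ Icc 0 T) :
    ∫ x, vortSq 0 (u t) x ≤ (∫ x, vortSq 0 (u 0) x) +
      (∫⁻ τ in Ioo 0 t, ENNReal.ofReal (432 * a τ * ∫ x, vortSq 0 (u τ) x)).toReal := by
  have hU := uniqueDiffOn_Icc hT
  have hcl := Icc_subset_closure_interior hT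
  have hu : ∀ τ ∈ Icc 0 T, ContDiff ℝ ∞ (u τ) := fun τ hτ => h.contDiff_velocity hτ
  -- bounds in the class
  obtain ⟨⟨I₀, hI₀⟩, ⟨P₀, hP₀0, hP₀⟩⟩ := levelSq_bounds_of_hasBoundedSobolevNormsOn hu hB 0
  obtain ⟨⟨I₁, hI₁⟩, -⟩ := levelSq_bounds_of_hasBoundedSobolevNormsOn hu hB 1
  have ha0 : ∀ τ ∈ Icc 0 T, 0 ≤ a τ := fun τ hτ => (norm_nonneg _).trans (ha τ hτ 0)
  have hvB : ∀ τ ∈ Icc 0 T, ∀ x, ‖u τ x‖ ≤ Real.sqrt P₀ := fun τ hτ x => by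
    refine Real.le_sqrt_of_sq_le ?_
    rw [← levelSq_zero_eq_norm_sq]; exact hP₀ τ hτ x
  have hXint : ∀ τ ∈ Icc 0 T, Integrable (vortSq 0 (u τ)) := fun τ hτ =>
    ((hI₁ τ hτ).1.const_mul 4).mono' (continuous_vortSq (hu τ hτ) 0).aestronglyMeasurable
      (Eventually.of_forall fun x => by
        rw [Real.norm_of_nonneg (vortSq_nonneg 0 _ x)]
        exact vortSq_le_four_mul_levelSq_succ (hu τ hτ) 0 x)
  have hXle : ∀ τ ∈ Icc 0 T, ∫ x, vortSq 0 (u τ) x ≤ 4 * I₁ := fun τ hτ => by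
    calc ∫ x, vortSq 0 (u τ) x ≤ ∫ x, 4 * levelSq 1 (u τ) x :=
          integral_mono (hXint τ hτ) ((hI₁ τ hτ).1.const_mul 4) fun x =>
            vortSq_le_four_mul_levelSq_succ (hu τ hτ) 0 x
      _ = 4 * ∫ x, levelSq 1 (u τ) x := integral_const_mul _ _
      _ ≤ 4 * I₁ := by linarith [(hI₁ τ hτ).2]
  have hX0 : ∀ τ ∈ Icc 0 T, 0 ≤ ∫ x, vortSq 0 (u τ) x := fun τ _ =>
    integral_nonneg fun x => vortSq_nonneg 0 _ x
  have hI₁0 : 0 ≤ 4 * I₁ := (hX0 0 ⟨le_rfl, hT.le⟩).trans (hXle 0 ⟨le_rfl, hT.le⟩)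
  -- div–curl at level zero: `∫|∇u|² ≤ ∫|Ω|²`
  have hL1 : ∀ τ ∈ Icc 0 T, ∫ x, levelSq 1 (u τ) x ≤ ∫ x, vortSq 0 (u τ) x := fun τ hτ =>
    integral_levelSq_succ_le_integral_vortSq (hu τ hτ) (fun x => h.sum_pderiv_comp_eq_zero hτ x) 0
      (hI₀ τ hτ).1 (hI₁ τ hτ).1
  -- the cutoff gradient constant
  obtain ⟨C, hC0, hC⟩ := exists_norm_fderiv_cutoff_le (E := (EuclideanSpace ℝ (Fin 3)))
  set E : ℝ := (96 * ν * C ^ 2 + 12 * C * Real.sqrt P₀) * (4 * I₁) with hE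
  have hE0 : 0 ≤ E := by rw [hE]; positivity
  refine h.integral_vortSq_le_of_slice_bound hT 0 hXint (m := fun τ => 432 * a τ * ∫ x, vortSq 0 (u τ) x)
    (M := 432 * amax * (4 * I₁)) (fun τ hτ => by positivity [ha0 τ hτ, hX0 τ hτ]) (fun τ hτ => ?_) hE0
    (fun R hR τ hτ => ?_) ht
  · exact mul_le_mul (mul_le_mul_of_nonneg_left (hamax τ hτ) (by norm_num)) (hXle τ hτ) (hX0 τ hτ)
      (by nlinarith [ha0 τ hτ, hamax τ hτ])
  · -- the slice bound at level zero
    have hR0 : 0 < R := by linarith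
    have hv : ContDiff ℝ ∞ (u τ) := hu τ hτ
    have hdiv : ∀ x, ∑ i, pderiv i (fun y => u τ y i) x = 0 := fun x => h.sum_pderiv_comp_eq_zero hτ x
    have hWc : ∀ c', Continuous fun x =>
        timeDerivWithin (Icc 0 T) (fun s y => vortFam 0 (u s) c' y) τ x := fun c' =>
      (((h.isSmoothSpaceTimeOn_vortFam hT 0 c').timeDerivWithin hU).contDiff_slice hτ).continuous
    have hforce : ∀ c' x, |timeDerivWithin (Icc 0 T) (fun s y => vortFam 0 (u s) c' y) τ x -
          ν * ∑ j, pderiv j (pderiv j (vortFam 0 (u τ) c')) x +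
          ∑ j, u τ x j * pderiv j (vortFam 0 (u τ) c') x| ≤ 12 * levelSq 1 (u τ) x := by
      intro c' x
      have := h.abs_vorticity_forcing_le hU hcl hτ x c'.1 c'.2.1 c'.2.2
      rw [Fintype.card_fin] at this
      push_cast at this
      refine this.trans (le_of_eq ?_)
      rw [Finset.Icc_self, Finset.sum_singleton, show (2 - 1 : ℕ) = 1 from rfl,
        Real.mul_self_sqrt (levelSq_nonneg 1 _ x)]
      norm_num
    have hcφ : ∀ x, ‖fderiv ℝ (cutoff R) x‖ ≤ C / R := hC R hR0
    have hmain := bkm_pairing_le_zero hν (div_nonneg hC0 hR0.le) (ha0 τ hτ) hv hdiv (hvB τ hτ)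
      (ha τ hτ) (hI₁ τ hτ).1 (contDiff_cutoff R) (hasCompactSupport_cutoff hR0) (cutoff_nonneg R)
      (cutoff_le_one R) hcφ _ hWc hforce
    refine hmain.trans ?_
    have hXτ := hXle τ hτ
    have hXτ0 := hX0 τ hτ
    have hL := hL1 τ hτ
    have hcR : (C / R) ^ 2 ≤ C ^ 2 / R := by
      rw [div_pow, sq R, ← div_div]
      exact div_le_div_of_nonneg_right (div_le_self (sq_nonneg C) hR) hR0.le
    have herr : (96 * ν * (C / R) ^ 2 + 12 * (C / R) * Real.sqrt P₀) * (∫ x, vortSq 0 (u τ) x) ≤ E / R := by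
      rw [hE]
      have h1 : 96 * ν * (C / R) ^ 2 + 12 * (C / R) * Real.sqrt P₀ ≤
          (96 * ν * C ^ 2 + 12 * C * Real.sqrt P₀) / R := by
        rw [add_div]
        refine add_le_add ?_ (le_of_eq (by ring))
        calc 96 * ν * (C / R) ^ 2 ≤ 96 * ν * (C ^ 2 / R) := mul_le_mul_of_nonneg_left hcR (by positivity)
          _ = 96 * ν * C ^ 2 / R := by ring
      calc (96 * ν * (C / R) ^ 2 + 12 * (C / R) * Real.sqrt P₀) * (∫ x, vortSq 0 (u τ) x)
          ≤ (96 * ν * C ^ 2 + 12 * C * Real.sqrt P₀) / R * (4 * I₁) :=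
            mul_le_mul h1 hXτ hXτ0 (by positivity)
        _ = (96 * ν * C ^ 2 + 12 * C * Real.sqrt P₀) * (4 * I₁) / R := by ring
    have hstretch : 432 * a τ * ∫ x, levelSq 1 (u τ) x ≤ 432 * a τ * ∫ x, vortSq 0 (u τ) x :=
      mul_le_mul_of_nonneg_left hL (by positivity [ha0 τ hτ])
    linarith

/-- **The integrated `H³`-level vorticity inequality in the BKM class** (Majda–Bertozzi (3.79)
with `m = 3`, run on the vorticity equation: `d/dt ‖∇²ω‖₀² ≤ C |∇v|_{L^∞} ‖∇²ω‖₀²`, integrated).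
For `ν ≥ 0` and an unforced classical solution on `[0, T] × ℝ³` all of whose Sobolev seminorms
are bounded on `[0, T]`, and any majorant `G(τ) ≥ sup_x ‖Du(τ)‖` bounded on `[0, T]`: for every
`t ∈ [0, T]`, `∫|∇²Ω(t)|² ≤ ∫|∇²Ω(0)|² + ∫₀ᵗ 979776 G(τ) ∫|∇²Ω(τ)|² dτ` (lower Lebesgue
integral in time). [cite: MajdaBertozzi2002, §3.3 proof of Thm. 3.6, (3.79) with §3.2 Prop. 3.7 (pp. 104, 116)] -/
theorem IsClassicalNSSolutionOn.bkm_vortSq_two_le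
    (h : IsClassicalNSSolutionOn (Icc 0 T) ν 0 u p) (hν : 0 ≤ ν) (hT : 0 < T)
    (hB : HasBoundedSobolevNormsOn (Icc 0 T) u)
    {G : ℝ → ℝ} {Gmax : ℝ} (hG : ∀ τ ∈ Icc 0 T, ∀ x, ‖fderiv ℝ (u τ) x‖ ≤ G τ)
    (hGmax : ∀ τ ∈ Icc 0 T, G τ ≤ Gmax) {t : ℝ} (ht : t ∈ Icc 0 T) :
    ∫ x, vortSq 2 (u t) x ≤ (∫ x, vortSq 2 (u 0) x) +
      (∫⁻ τ in Ioo 0 t, ENNReal.ofReal (979776 * G τ * ∫ x, vortSq 2 (u τ) x)).toReal := by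
  have hU := uniqueDiffOn_Icc hT
  have hcl := Icc_subset_closure_interior hT
  have hu : ∀ τ ∈ Icc 0 T, ContDiff ℝ ∞ (u τ) := fun τ hτ => h.contDiff_velocity hτ
  -- bounds in the class
  obtain ⟨-, ⟨P₀, hP₀0, hP₀⟩⟩ := levelSq_bounds_of_hasBoundedSobolevNormsOn hu hB 0
  obtain ⟨⟨I₂, hI₂⟩, ⟨P₂, -, hP₂⟩⟩ := levelSq_bounds_of_hasBoundedSobolevNormsOn hu hB 2
  obtain ⟨⟨I₃, hI₃⟩, ⟨P₃, -, hP₃⟩⟩ := levelSq_bounds_of_hasBoundedSobolevNormsOn hu hB 3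
  have hG0 : ∀ τ ∈ Icc 0 T, 0 ≤ G τ := fun τ hτ => (norm_nonneg _).trans (hG τ hτ 0)
  have hvB : ∀ τ ∈ Icc 0 T, ∀ x, ‖u τ x‖ ≤ Real.sqrt P₀ := fun τ hτ x => by
    refine Real.le_sqrt_of_sq_le ?_
    rw [← levelSq_zero_eq_norm_sq]; exact hP₀ τ hτ x
  have hD : ∀ τ ∈ Icc 0 T, ∀ x, levelSq 1 (u τ) x ≤ (3 * G τ) ^ 2 := fun τ hτ x => by
    calc levelSq 1 (u τ) x ≤ 3 ^ (1 + 1) * ‖iteratedFDeriv ℝ 1 (u τ) x‖ ^ 2 :=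
          levelSq_le_pow_mul_sq_norm_iteratedFDeriv (hu τ hτ) 1 x
      _ ≤ 3 ^ (1 + 1) * G τ ^ 2 := by
          gcongr
          rw [← norm_iteratedFDeriv_fderiv (n := 0), norm_iteratedFDeriv_zero]
          exact hG τ hτ x
      _ = (3 * G τ) ^ 2 := by ring
  have hXint : ∀ τ ∈ Icc 0 T, Integrable (vortSq 2 (u τ)) := fun τ hτ =>
    ((hI₃ τ hτ).1.const_mul 4).mono' (continuous_vortSq (hu τ hτ) 2).aestronglyMeasurable
      (Eventually.of_forall fun x => by
        rw [Real.norm_of_nonneg (vortSq_nonneg 2 _ x)]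
        exact vortSq_le_four_mul_levelSq_succ (hu τ hτ) 2 x)
  have hXle : ∀ τ ∈ Icc 0 T, ∫ x, vortSq 2 (u τ) x ≤ 4 * I₃ := fun τ hτ => by
    calc ∫ x, vortSq 2 (u τ) x ≤ ∫ x, 4 * levelSq 3 (u τ) x :=
          integral_mono (hXint τ hτ) ((hI₃ τ hτ).1.const_mul 4) fun x =>
            vortSq_le_four_mul_levelSq_succ (hu τ hτ) 2 x
      _ = 4 * ∫ x, levelSq 3 (u τ) x := integral_const_mul _ _
      _ ≤ 4 * I₃ := by linarith [(hI₃ τ hτ).2]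
  have hX0 : ∀ τ ∈ Icc 0 T, 0 ≤ ∫ x, vortSq 2 (u τ) x := fun τ _ =>
    integral_nonneg fun x => vortSq_nonneg 2 _ x
  have hI₃0 : 0 ≤ 4 * I₃ := (hX0 0 ⟨le_rfl, hT.le⟩).trans (hXle 0 ⟨le_rfl, hT.le⟩)
  -- the cutoff gradient constant and the error constant
  obtain ⟨C, hC0, hC⟩ := exists_norm_fderiv_cutoff_le (E := (EuclideanSpace ℝ (Fin 3)))
  set E : ℝ := (96 * ν * C ^ 2 + 12 * C * Real.sqrt P₀) * (4 * I₃) with hE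
  have hE0 : 0 ≤ E := by rw [hE]; positivity
  refine h.integral_vortSq_le_of_slice_bound hT 2 hXint (m := fun τ => 979776 * G τ * ∫ x, vortSq 2 (u τ) x)
    (M := 979776 * Gmax * (4 * I₃)) (fun τ hτ => by positivity [hG0 τ hτ, hX0 τ hτ]) (fun τ hτ => ?_)
    hE0 (fun R hR τ hτ => ?_) ht
  · exact mul_le_mul (mul_le_mul_of_nonneg_left (hGmax τ hτ) (by norm_num)) (hXle τ hτ) (hX0 τ hτ)
      (by nlinarith [hG0 τ hτ, hGmax τ hτ])
  · -- the slice bound at level two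
    have hR0 : 0 < R := by linarith
    have hv : ContDiff ℝ ∞ (u τ) := hu τ hτ
    have hdiv : ∀ x, ∑ i, pderiv i (fun y => u τ y i) x = 0 := fun x => h.sum_pderiv_comp_eq_zero hτ x
    have hWc : ∀ c', Continuous fun x =>
        timeDerivWithin (Icc 0 T) (fun s y => vortFam 2 (u s) c' y) τ x := fun c' =>
      (((h.isSmoothSpaceTimeOn_vortFam hT 2 c').timeDerivWithin hU).contDiff_slice hτ).continuous
    have hforce : ∀ c' x, |timeDerivWithin (Icc 0 T) (fun s y => vortFam 2 (u s) c' y) τ x -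
          ν * ∑ j, pderiv j (pderiv j (vortFam 2 (u τ) c')) x +
          ∑ j, u τ x j * pderiv j (vortFam 2 (u τ) c') x| ≤
        48 * ∑ a ∈ Finset.Icc 1 (2 + 1),
          Real.sqrt (levelSq a (u τ) x) * Real.sqrt (levelSq (2 + 2 - a) (u τ) x) := by
      intro c' x
      have := h.abs_vorticity_forcing_le hU hcl hτ x c'.1 c'.2.1 c'.2.2
      rw [Fintype.card_fin] at this
      push_cast at this
      refine this.trans (le_of_eq ?_)
      norm_num
    have hcφ : ∀ x, ‖fderiv ℝ (cutoff R) x‖ ≤ C / R := hC R hR0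
    have hmain := bkm_pairing_le_two hν (div_nonneg hC0 hR0.le) hv hdiv (hvB τ hτ) (hD τ hτ)
      (hP₂ τ hτ) (hP₃ τ hτ) (hI₂ τ hτ).1 (hI₃ τ hτ).1 (contDiff_cutoff R)
      (hasCompactSupport_cutoff hR0) (cutoff_nonneg R) (cutoff_le_one R) hcφ _ hWc hforce
    refine hmain.trans ?_
    have hXτ := hXle τ hτ
    have hXτ0 := hX0 τ hτ
    have hcR : (C / R) ^ 2 ≤ C ^ 2 / R := by
      rw [div_pow, sq R, ← div_div]
      exact div_le_div_of_nonneg_right (div_le_self (sq_nonneg C) hR) hR0.le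
    have habs : |3 * G τ| = 3 * G τ := abs_of_nonneg (by linarith [hG0 τ hτ])
    rw [habs]
    have herr : (96 * ν * (C / R) ^ 2 + 12 * (C / R) * Real.sqrt P₀) * (∫ x, vortSq 2 (u τ) x) ≤ E / R := by
      rw [hE]
      have h1 : 96 * ν * (C / R) ^ 2 + 12 * (C / R) * Real.sqrt P₀ ≤
          (96 * ν * C ^ 2 + 12 * C * Real.sqrt P₀) / R := by
        rw [add_div]
        refine add_le_add ?_ (le_of_eq (by ring))
        calc 96 * ν * (C / R) ^ 2 ≤ 96 * ν * (C ^ 2 / R) := mul_le_mul_of_nonneg_left hcR (by positivity)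
          _ = 96 * ν * C ^ 2 / R := by ring
      calc (96 * ν * (C / R) ^ 2 + 12 * (C / R) * Real.sqrt P₀) * (∫ x, vortSq 2 (u τ) x)
          ≤ (96 * ν * C ^ 2 + 12 * C * Real.sqrt P₀) / R * (4 * I₃) :=
            mul_le_mul h1 hXτ hXτ0 (by positivity)
        _ = (96 * ν * C ^ 2 + 12 * C * Real.sqrt P₀) * (4 * I₃) / R := by ring
    nlinarith [herr, hG0 τ hτ, hXτ0]

end Slab

end Literature.Analysis.FluidPDE
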